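import Summits.CriticalPhenomena.Ising3DConformalLimit.Theorems.EnergyNotSigmaSquaredMoebiusLimitExistsDefs
import Summits.CriticalPhenomena.Ising3DConformalLimit.Theorems.MoebiusLimitExists.Negative.PinnedClusterPoints
import Summits.CriticalPhenomena.Ising3DConformalLimit.Theorems.MoebiusLimitExists.Negative.FreeTranslations
import Literature.Probability.LatticeModels.CriticalScalingDimension
import HarnessLib

/-!
# The local-bounds sub-stub of `stub_compactness` CONTAINS axis doubling of `⟨σ₀σ_x⟩_{β_c}` on `ℤ³`
(crux `MoebiusLimitExists`, item stmt-CriticalPhenomena-1344; line `only-interaction-breaks-moebius`,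
registered sub-stub `pinnedZoomLocallyBounded` of `stub_compactness`; deep-refute gen-2, THEOREM-ONLY)

Load-bearing analysis of the registered sub-stub
`pinnedZoomLocallyBounded : ∀ Δ c, 0 < c → (⟨σ₀σ_y⟩‖y‖₂^{2Δ} → c) → ∀ u → 0⁺, ∀ n K ⋯, ∃ B, ∀ᶠ k, ∀ x ∈ K, |F_n(u_k)(x)| ≤ B`
(local bounds of the pinned zoom `F_n(δ) = ρ_pin(δ)ⁿ⟨∏σ_{[xᵢ/δ]}⟩_{β_c}`, `ρ_pin(δ)² = ⟨σ₀σ_{⌊1/δ⌋e₀}⟩⁻¹`,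
under the two-point law of item stmt-0634). Its CONCLUSION alone (the hypothesis-free mutation) already
contains an open lattice statement: evaluated at `n = 2` on the singleton compact `{(0, s e₀)}` along
the meshes `1/(k+1)`, the pinned zoom IS the two-point ratio `⟨σ₀σ_{⌊s(k+1)⌋e₀}⟩/⟨σ₀σ_{(k+1)e₀}⟩`
(`rescaled_pin_cfg0s`), so local bounds force AXIS DOUBLING
`⟨σ₀σ_{⌊sR⌋e₀}⟩_{β_c} ≤ B_s ⟨σ₀σ_{Re₀}⟩_{β_c}` for all large integers `R`, every `s ≠ 0`
(`axisDoubling_of_pinnedZoomLocallyBounded`; contentful for `0 < |s| < 1`). On `ℤ³` this is not a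
consequence of the known two-point bounds `c‖x‖⁻² ≤ ⟨σ₀σ_x⟩ ≤ C‖x‖⁻¹` (`criticalTwoPoint_bounds_holds`:
they only give `⟨σ₀σ_{⌊sR⌋e₀}⟩/⟨σ₀σ_{Re₀}⟩ ≤ C R/(c|s|)`, unbounded in `R`), so the 0634-type
hypothesis of the sub-stub cannot simply be dropped with the tree's present knowledge; conversely the
hypothesis is CONSUMED only through axis doubling: by Messager–Miracle-Solé
(`twoPointPlus_le_single_of_nonneg`, `twoPointPlus_add_single_le`, reflection to `|y|`) every lattice
displacement `z` with `‖z‖_∞ ≥ ⌊sR⌋` has `⟨σ₀σ_z⟩ ≤ ⟨σ₀σ_{⌊sR⌋e₀}⟩`, and Gaussian domination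
(`abs_criticalCorr_sub_pairingSum_le` / Newman) bounds `ρ_pin^{2m}⟨∏σ⟩` by `(2m−1)!!·B_s^m` on a compact
whose pairwise sup-distances are `≥ √3·s + (mesh)` — the prover's route to `pinnedZoomLocallyBounded`.

References: Messager–Miracle-Solé 1977; Duminil-Copin 2019 §4.3 Exercise 37; Simon 1980 / infrared
bound for the two known exponents.
-/

noncomputable section

open Filter Topology Set Function
open Literature.Probability.LatticeModels
open Summit.CriticalPhenomena.Ising3DConformalLimit.MoebiusLimitExistsOnlyInteraction

namespace Summit.CriticalPhenomena.Ising3DConformalLimit.MoebiusLimitExistsNegative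

/-- `[s e₀/δ] = ⌊s/δ⌋ e₀`. [folklore] -/
theorem latticeApprox_single_zero (δ s : ℝ) :
    latticeApprox δ (EuclideanSpace.single (0 : Fin 3) s) = Pi.single 0 ⌊s / δ⌋ := by
  funext i
  rw [latticeApprox_apply, PiLp.single_apply]
  by_cases hi : i = 0
  · subst hi; simp
  · rw [if_neg hi, Pi.single_eq_of_ne hi, zero_div, Int.floor_zero]

/-- **The pinned zoom at the axis pair `(0, s e₀)` is the two-point ratio**
`⟨σ₀σ_{⌊s/δ⌋e₀}⟩_{β_c} / ⟨σ₀σ_{⌊1/δ⌋e₀}⟩_{β_c}`. [folklore] -/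
theorem rescaled_pin_cfg0s (δ s : ℝ) :
    rescaledCorrelator (criticalCorr 3) rhoPin 2 δ
        (![0, EuclideanSpace.single 0 s] : Fin 2 → EuclideanSpace ℝ (Fin 3)) =
      criticalTwoPoint 3 (Pi.single 0 ⌊s / δ⌋) / criticalTwoPoint 3 (Pi.single 0 ⌊1 / δ⌋) := by
  rw [rescaledCorrelator_apply, latticeApprox_comp_two]
  simp only [Matrix.cons_val_zero, Matrix.cons_val_one]
  rw [latticeApprox_zero, latticeApprox_single_zero, criticalCorr_two]
  have hG := PinnedClusterPoints.criticalTwoPoint_pos3 (Pi.single 0 (⌊1 / δ⌋ : ℤ))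
  have h := PinnedClusterPoints.rhoPin_sq_mul δ
  rw [eq_div_iff hG.ne']
  calc rhoPin δ ^ 2 * criticalTwoPoint 3 (Pi.single 0 ⌊s / δ⌋) * criticalTwoPoint 3 (Pi.single 0 ⌊1 / δ⌋)
      = (rhoPin δ ^ 2 * criticalTwoPoint 3 (Pi.single 0 ⌊1 / δ⌋)) *
          criticalTwoPoint 3 (Pi.single 0 ⌊s / δ⌋) := by ring
    _ = criticalTwoPoint 3 (Pi.single 0 ⌊s / δ⌋) := by rw [h, one_mul]

/-- **Local bounds of the pinned zoom force axis doubling of the critical two-point function.**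
The conclusion of the registered sub-stub `pinnedZoomLocallyBounded` (for all mesh sequences, here
used only at `n = 2`, `K = {(0, s e₀)}`, `u_k = 1/(k+1)`) implies
`⟨σ₀σ_{⌊s(k+1)⌋e₀}⟩_{β_c} ≤ B ⟨σ₀σ_{(k+1)e₀}⟩_{β_c}` for all large `k`, for every `s ≠ 0` — for
`0 < |s| < 1` the (open on `ℤ³`) doubling property of `⟨σ₀σ_x⟩_{β_c}` along an axis.
[cite: DuminilCopinICM2022, §8.1 eq. (8.1) and §8.4 p. 29] -/
theorem axisDoubling_of_pinnedZoomLocallyBounded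
    (h : ∀ u : ℕ → ℝ, Tendsto u atTop (𝓝[>] (0 : ℝ)) →
      ∀ n (K : Set (Fin n → EuclideanSpace ℝ (Fin 3))), IsCompact K → K ⊆ NonCoincident 3 n →
        ∃ B : ℝ, ∀ᶠ k in atTop, ∀ x ∈ K, |rescaledCorrelator (criticalCorr 3) rhoPin n (u k) x| ≤ B)
    {s : ℝ} (hs : s ≠ 0) :
    ∃ B : ℝ, ∀ᶠ k : ℕ in atTop,
      criticalTwoPoint 3 (Pi.single 0 ⌊s * ((k : ℝ) + 1)⌋) ≤
        B * criticalTwoPoint 3 (Pi.single 0 ((k : ℤ) + 1)) := by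
  have hu : Tendsto (fun k : ℕ => (1 : ℝ) / ((k : ℝ) + 1)) atTop (𝓝[>] (0 : ℝ)) :=
    tendsto_div_succ_nhdsGT one_pos
  set x₀ : Fin 2 → EuclideanSpace ℝ (Fin 3) := ![0, EuclideanSpace.single 0 s] with hx₀def
  have hx₀ : x₀ ∈ NonCoincident 3 2 := zero_unitVec_mem_nonCoincident hs
  obtain ⟨B, hB⟩ := h _ hu 2 {x₀} isCompact_singleton (singleton_subset_iff.2 hx₀)
  refine ⟨B, ?_⟩
  filter_upwards [hB] with k hk
  have hk0 := hk x₀ (mem_singleton _)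
  rw [hx₀def, rescaled_pin_cfg0s] at hk0
  have hfloor1 : ⌊1 / (1 / ((k : ℝ) + 1))⌋ = (k : ℤ) + 1 := by
    rw [one_div_one_div]
    have : ((k : ℝ) + 1) = (((k : ℤ) + 1 : ℤ) : ℝ) := by push_cast; ring
    rw [this, Int.floor_intCast]
  have hfloors : s / (1 / ((k : ℝ) + 1)) = s * ((k : ℝ) + 1) := by
    rw [div_eq_mul_one_div, one_div_one_div]
  rw [hfloor1, hfloors] at hk0
  have hG := PinnedClusterPoints.criticalTwoPoint_pos3 (Pi.single 0 ((k : ℤ) + 1))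
  exact (div_le_iff₀ hG).1 (abs_le.1 hk0).2

/-- The same with the sub-stub's own hypotheses in place (its 0634-type datum for SOME exponent):
`pinnedZoomLocallyBounded` as registered implies, given any `Δ, c > 0` with
`⟨σ₀σ_y⟩‖y‖₂^{2Δ} → c`, the axis doubling bound — recorded so that the implication
"sub-stub ⇒ doubling" is available verbatim against the registered signature. [folklore] -/
theorem axisDoubling_of_pinnedZoomLocallyBounded'
    (h : ∀ (Δ c : ℝ), 0 < c →
      Tendsto (fun y : Site 3 => criticalTwoPoint 3 y * Real.sqrt (∑ i, ((y i : ℝ)) ^ 2) ^ (2 * Δ))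
        cofinite (𝓝 c) →
      ∀ u : ℕ → ℝ, Tendsto u atTop (𝓝[>] (0 : ℝ)) →
        ∀ n (K : Set (Fin n → EuclideanSpace ℝ (Fin 3))), IsCompact K → K ⊆ NonCoincident 3 n →
          ∃ B : ℝ, ∀ᶠ k in atTop, ∀ x ∈ K, |rescaledCorrelator (criticalCorr 3) rhoPin n (u k) x| ≤ B)
    {Δ c : ℝ} (hc : 0 < c)
    (hlaw : Tendsto (fun y : Site 3 => criticalTwoPoint 3 y * Real.sqrt (∑ i, ((y i : ℝ)) ^ 2) ^ (2 * Δ))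
      cofinite (𝓝 c))
    {s : ℝ} (hs : s ≠ 0) :
    ∃ B : ℝ, ∀ᶠ k : ℕ in atTop,
      criticalTwoPoint 3 (Pi.single 0 ⌊s * ((k : ℝ) + 1)⌋) ≤
        B * criticalTwoPoint 3 (Pi.single 0 ((k : ℤ) + 1)) :=
  axisDoubling_of_pinnedZoomLocallyBounded (h Δ c hc hlaw) hs

end Summit.CriticalPhenomena.Ising3DConformalLimit.MoebiusLimitExistsNegative

end
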